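import Summits.NavierStokesRegularity.FluidComputer.DampedTransitionDouse

/-!
# Tao's delay gate under NON-UNIFORM diagonal damping, part 7: (toke), (beable) and the damped gate theorem

Companion of `DampedTransition{,Quiet,Window,Fire,Douse}.lean` (cell `pub-fluidc`, seat bp1). HONEST FRAMING
(verbatim): low prior, high value-of-information experiment on Tao's machine paradigm; NOT a claim that NS blows
up. Five-mode truncation (5.5) of [Tao2016AveragedNS, §5.5] with a diagonal damping `-E(t) * X(t)`,
`0 ≤ Eᵢ(t) ≤ η`, on `[0,2]`; nothing is proved about Navier–Stokes.

Third and last file of the FIRING phase (bp1 item S1b; plan `pub-fluidc-bp1/PLAN-S1b-firing-damped.md`):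
* `KVe_small` — `|½KVã| ≤ ½K⁻⁹⁹` on `I = [t_c + δ, 2]`;
* `Es_decay` — **(toke)**: Grönwall at the constant rate `K/10` from `t' = t_c + δ + 1/K`:
  `E_*(t) ≤ e^{(1-√K)/10} + 70K⁻⁹⁰` on `[t_c + δ + 1/√K, 2]` — print's exponent and constants;
* `late_sum_sq`, `beable_of_sum_sq` — **(beable), damped**: `a² + b² + c² + d² ≤ 142K⁻²⁰`, hence
  `|ã - 1| ≤ 200K⁻¹⁰ + 4η` (the `4η ≥ 2ηt` is the energy the damping has eaten — it cannot be better) and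
  `|a|, |b|, |c|, |d| ≤ 200K⁻¹⁰` on `[t_c + δ + 1/√K, 2]`;
* `able_window` — (able) on all of `[0, t_c]`: `|a - 1| ≤ 200K⁻¹⁰ + 2η`, the rest `≤ 200K⁻¹⁰`;
* `family_params_damped`, `window_fits_damped` — the onset delay is `δ = 888 log K / M` (print/undamped:
  `880 log K / M`), i.e. `K¹¹¹ ≤ e^{Mδ/8}`; the second window still fits in `[0,2]` for `η ≤ 1/1000`;
* `firingPhase` — **THE DAMPED GATE THEOREM** (Thm 5.3 for the family `3000 log K ≤ M ≤ K¹⁰`,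
  `K ≥ 2·20⁴²·42! + 16`, `0 < ε ≤ e^{-10M}/K¹⁰⁰`, under ANY measurable-free, merely pointwise-bounded diagonal
  damping `0 ≤ Eᵢ(t) ≤ η ≤ 1/1000` on `[0,2]`): a critical time `t_c` with `|t_c - √2| ≤ 24 log K/M + 20η`,
  (able) on `[0, t_c]`, (beable) on `[t_c + 888 log K/M + 1/√K, 2]`, levels `200K⁻¹⁰ + O(η)`.
The undamped `Thm53With.transitionWith_explicit` is the case `E = 0` restricted to `[0,2]` (with `880 ↦ 888`).
[cite: Tao2016AveragedNS, §5.5 Thm 5.3 proof: (toke), (beable), (able)]. No named facts; 0 sorry.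
-/

noncomputable section

namespace Summit.NavierStokesRegularity.FluidComputer

open Real Set Filter Topology
open Literature.Analysis.FluidPDE.Tao2016AveragedNS
open Literature.Analysis.FluidPDE.Tao2016AveragedNS.Thm53 (antitoneOn_intFactor invSqrt_facts decay_alg)
open Literature.Analysis.FluidPDE.Tao2016AveragedNS.Thm53With (family_params eps_facts abs_sub_sqrt_two_le)

namespace DampedTransition

section Decay

variable {K M ε η τ δ : ℝ} {E X : ℝ → Fin 5 → ℝ}

/-- On `I = [t_c + δ, 2]`: `|½K·V·ã| ≤ ½K⁻⁹⁹` (`V = adε²/c`, `ε²/c ≤ K⁻¹⁰⁰`).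
[cite: Tao2016AveragedNS, §5.5 (proof of (beable))] -/
theorem KVe_small
    (hX : ∀ t ∈ Icc (0:ℝ) 2, HasDerivAt X (delayCircuitWith K M ε (X t) - E t * X t) t)
    (hE : ∀ t ∈ Icc (0:ℝ) 2, ∀ i, 0 ≤ E t i ∧ E t i ≤ η) (h0 : X 0 = delayInit)
    (hε : 0 < ε) (hε1 : ε ≤ 1) (hM0 : 0 < M) (hMK : M ≤ K ^ 10) (hK : 16 ≤ K) (hεK : ε ^ 2 ≤ 1 / (6 * K ^ 20))
    (hεexp : ε ^ 2 ≤ exp (-(18 * M)) / (64 * M)) (hη : η ≤ 1 / 100)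
    (hδ : 0 ≤ δ) (hon : K ^ 111 ≤ exp (M * δ / 8))
    (hτ1 : 1 ≤ τ) (hτ2 : τ ≤ 2)
    (hcτ : ∀ t, 0 ≤ t → t ≤ τ → X t 2 ≤ ε ^ 2 / K ^ 10) (hcτeq : X τ 2 = ε ^ 2 / K ^ 10)
    {s : ℝ} (hs : s ∈ Icc (τ + δ) 2) :
    |K / 2 * (X s 0 * X s 3 * (ε ^ 2 * (X s 2)⁻¹) * X s 4)| ≤ 1 / 2 / K ^ 99 := by
  have hK0 : 0 < K := by linarith
  have hs02 : s ∈ Icc (0 : ℝ) 2 := ⟨by linarith [hs.1], hs.2⟩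
  have hcl : K ^ 100 * ε ^ 2 ≤ X s 2 :=
    c_large hX hE h0 hε hε1 hM0 hMK hK hεK hεexp hη hδ hon hτ1 hτ2 hcτ hcτeq hs
  have hcpos : 0 < X s 2 := lt_of_lt_of_le (by positivity) hcl
  have hq0 : 0 ≤ ε ^ 2 * (X s 2)⁻¹ := by positivity
  have hq : ε ^ 2 * (X s 2)⁻¹ ≤ 1 / K ^ 100 := by
    rw [← div_eq_mul_inv, div_le_div_iff₀ hcpos (by positivity), one_mul]; linarith
  rw [abs_mul, abs_of_pos (by positivity : 0 < K / 2), abs_mul, abs_mul, abs_mul,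
    abs_of_nonneg hq0]
  calc K / 2 * (|X s 0| * |X s 3| * (ε ^ 2 * (X s 2)⁻¹) * |X s 4|)
      ≤ K / 2 * (1 * 1 * (1 / K ^ 100) * 1) := by
        refine mul_le_mul_of_nonneg_left ?_ (by positivity)
        exact mul_le_mul (mul_le_mul (mul_le_mul (traj_abs_le_one hX hE h0 hs02 0)
          (traj_abs_le_one hX hE h0 hs02 3) (abs_nonneg _) zero_le_one) hq hq0 (by norm_num))
          (traj_abs_le_one hX hE h0 hs02 4) (abs_nonneg _) (by positivity)
    _ = 1 / 2 / K ^ 99 := by field_simp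

/-- **(toke)**: Grönwall for `E_*` at the constant rate `K/10` from `t' = t_c + δ + 1/K`, evaluated on
`[t_c + δ + 1/√K, 2]`: `E_*(t) ≤ e^{-(K/10)(t-t')}·1 + 70K⁻⁹⁰ ≤ e^{(1-√K)/10} + 70K⁻⁹⁰`.
[cite: Tao2016AveragedNS, §5.5 (toke), (proof of (beable))] -/
theorem Es_decay
    (hX : ∀ t ∈ Icc (0:ℝ) 2, HasDerivAt X (delayCircuitWith K M ε (X t) - E t * X t) t)
    (hE : ∀ t ∈ Icc (0:ℝ) 2, ∀ i, 0 ≤ E t i ∧ E t i ≤ η) (h0 : X 0 = delayInit)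
    (hε : 0 < ε) (hε1 : ε ≤ 1) (hM0 : 0 < M) (hMK : M ≤ K ^ 10) (hK : 16 ≤ K) (hεK : ε ^ 2 ≤ 1 / (6 * K ^ 20))
    (hε100 : ε ≤ 1 / K ^ 100) (hεexp : ε ^ 2 ≤ exp (-(18 * M)) / (64 * M)) (hη : η ≤ 1 / 100)
    (hδ : 0 ≤ δ) (hon : K ^ 111 ≤ exp (M * δ / 8))
    (hτ1 : 1 ≤ τ) (hfit : τ + δ + (sqrt K)⁻¹ ≤ 2)
    (hcτ : ∀ t, 0 ≤ t → t ≤ τ → X t 2 ≤ ε ^ 2 / K ^ 10) (hcτeq : X τ 2 = ε ^ 2 / K ^ 10)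
    {t : ℝ} (ht : t ∈ Icc (τ + δ + 1 / sqrt K) 2) :
    (X t 0 ^ 2 + X t 1 ^ 2 + X t 2 ^ 2 + X t 3 ^ 2) / 2
        - K / 2 * (X t 0 * X t 3 * (ε ^ 2 * (X t 2)⁻¹) * X t 4)
      ≤ exp ((1 - sqrt K) / 10) + 70 / K ^ 90 := by
  have hK0 : 0 < K := by linarith
  have hK1 : 1 ≤ K := by linarith
  obtain ⟨hs0, hs4, hKs, h4, hKs2⟩ := invSqrt_facts hK
  have hτ2 : τ ≤ 2 := by linarith
  have hu0' : 0 < K⁻¹ := inv_pos.2 hK0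
  have hκ : 0 < K / 10 := by positivity
  have hKinv : K⁻¹ ≤ (sqrt K)⁻¹ := by
    rw [inv_le_inv₀ hK0 (by positivity)]
    calc sqrt K ≤ sqrt K * sqrt K := le_mul_of_one_le_right (by positivity) (by linarith)
      _ = K := mul_self_sqrt hK0.le
  have ht't : τ + δ + K⁻¹ ≤ t := by rw [one_div] at ht; linarith [ht.1]
  have hI : ∀ s ∈ Icc (τ + δ + K⁻¹) 2, s ∈ Icc (τ + δ) 2 := fun s hs =>
    ⟨by linarith [hs.1], hs.2⟩
  have ht'02 : τ + δ + K⁻¹ ∈ Icc (0:ℝ) 2 := ⟨by linarith, by linarith⟩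
  have hC0 : 0 ≤ 7 / K ^ 89 / (K / 10) := by positivity
  have hanti := antitoneOn_intFactor (s := Icc (τ + δ + K⁻¹) 2)
    (f := fun s => (X s 0 ^ 2 + X s 1 ^ 2 + X s 2 ^ 2 + X s 3 ^ 2) / 2
      - K / 2 * (X s 0 * X s 3 * (ε ^ 2 * (X s 2)⁻¹) * X s 4))
    (g := fun _ => -(K / 10)) (G := fun s => -(K / 10 * s))
    (φ := fun s => 7 / K ^ 89 * exp (K / 10 * s))
    (Φ := fun s => 7 / K ^ 89 / (K / 10) * exp (K / 10 * s))
    (convex_Icc _ 2)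
    (fun s hs => by
      have hsI := hI s hs
      have hs02 : s ∈ Icc (0:ℝ) 2 := ⟨by linarith [hs.1], hs.2⟩
      have hcl : K ^ 100 * ε ^ 2 ≤ X s 2 :=
        c_large hX hE h0 hε hε1 hM0 hMK hK hεK hεexp hη hδ hon hτ1 hτ2 hcτ hcτeq hsI
      have hcne : X s 2 ≠ 0 := (lt_of_lt_of_le (by positivity) hcl).ne'
      exact hasDerivAt_Es (hX s hs02) hε.ne' hcne)
    (fun s _ => ((hasDerivAt_id s).const_mul (K / 10)).neg.congr_deriv (by simp))
    (fun s _ => by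
      have hne : K / 10 ≠ 0 := hκ.ne'
      have := (((hasDerivAt_id s).const_mul (K / 10)).exp).const_mul (7 / K ^ 89 / (K / 10))
      refine this.congr_deriv ?_
      simp only [mul_one, id_eq]
      field_simp)
    (fun s hs => by
      have hdis := Es_dissipation hX hE h0 hε hε1 hM0 hMK hK hεK hε100 hεexp hη hδ hon hτ1 hfit hcτ
        hcτeq hs
      have hE' : exp (-(-(K / 10 * s))) = exp (K / 10 * s) := by rw [neg_neg]
      rw [hE']
      have h2 := mul_le_mul_of_nonneg_right hdis (exp_pos (K / 10 * s)).le
      linarith)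
  have ht'mem : τ + δ + K⁻¹ ∈ Icc (τ + δ + K⁻¹) 2 := ⟨le_rfl, by linarith⟩
  have htmem : t ∈ Icc (τ + δ + K⁻¹) 2 := ⟨ht't, ht.2⟩
  have hA := hanti ht'mem htmem ht't
  simp only [neg_neg] at hA
  have hsplit : exp (K / 10 * (τ + δ + K⁻¹))
      = exp (K / 10 * t) * exp (K / 10 * ((τ + δ + K⁻¹) - t)) := by
    rw [← exp_add]; congr 1; ring
  rw [hsplit] at hA
  -- `E_*(t') ≤ 1`
  have hEs1 : (X (τ + δ + K⁻¹) 0 ^ 2 + X (τ + δ + K⁻¹) 1 ^ 2 + X (τ + δ + K⁻¹) 2 ^ 2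
        + X (τ + δ + K⁻¹) 3 ^ 2) / 2
      - K / 2 * (X (τ + δ + K⁻¹) 0 * X (τ + δ + K⁻¹) 3 * (ε ^ 2 * (X (τ + δ + K⁻¹) 2)⁻¹)
        * X (τ + δ + K⁻¹) 4) ≤ 1 := by
    obtain ⟨-, hS1⟩ := sum_sq_sandwich hX hE h0 ht'02
    have h2 := (abs_le.1 (KVe_small hX hE h0 hε hε1 hM0 hMK hK hεK hεexp hη hδ hon hτ1 hτ2 hcτ hcτeq
      (hI _ ht'mem))).1
    have h3 : 1 / 2 / K ^ 99 ≤ 1 / 2 := by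
      rw [div_le_iff₀ (by positivity)]
      have : (1 : ℝ) ≤ K ^ 99 := one_le_pow₀ hK1
      linarith
    linarith [sq_nonneg (X (τ + δ + K⁻¹) 4)]
  have hρ0 : 0 < exp (K / 10 * ((τ + δ + K⁻¹) - t)) := exp_pos _
  have hEst := decay_alg (exp_pos _) hρ0 hC0 hEs1 hA
  -- `ρ ≤ exp((1 - √K)/10)`
  have hρle : exp (K / 10 * ((τ + δ + K⁻¹) - t)) ≤ exp ((1 - sqrt K) / 10) := by
    rw [exp_le_exp]
    have h2 : K / 10 * ((τ + δ + K⁻¹) - t) ≤ K / 10 * (K⁻¹ - (sqrt K)⁻¹) := by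
      refine mul_le_mul_of_nonneg_left ?_ hκ.le
      rw [one_div] at ht; linarith [ht.1]
    have h3 : K / 10 * (K⁻¹ - (sqrt K)⁻¹) = (1 - sqrt K) / 10 := by
      have hKK : K * K⁻¹ = 1 := mul_inv_cancel₀ hK0.ne'
      calc K / 10 * (K⁻¹ - (sqrt K)⁻¹) = (K * K⁻¹ - K * (sqrt K)⁻¹) / 10 := by ring
        _ = (1 - sqrt K) / 10 := by rw [hKs, hKK]
    linarith
  have hCle : 7 / K ^ 89 / (K / 10) ≤ 70 / K ^ 90 := by
    rw [div_le_div_iff₀ hκ (by positivity)]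
    calc 7 / K ^ 89 * K ^ 90 = 7 * K := by field_simp
      _ ≤ 70 * (K / 10) := by linarith
  linarith

/-- **(toke) ⇒ (beable), core estimate**: on `[t_c + δ + 1/√K, 2]`, `a² + b² + c² + d² ≤ 142K⁻²⁰`
(`= 2E_* + KVã`; needs `2e^{(1-√K)/10} ≤ K⁻²⁰`). [cite: Tao2016AveragedNS, §5.5 (beable)] -/
theorem late_sum_sq
    (hX : ∀ t ∈ Icc (0:ℝ) 2, HasDerivAt X (delayCircuitWith K M ε (X t) - E t * X t) t)
    (hE : ∀ t ∈ Icc (0:ℝ) 2, ∀ i, 0 ≤ E t i ∧ E t i ≤ η) (h0 : X 0 = delayInit)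
    (hε : 0 < ε) (hε1 : ε ≤ 1) (hM0 : 0 < M) (hMK : M ≤ K ^ 10) (hK : 16 ≤ K) (hεK : ε ^ 2 ≤ 1 / (6 * K ^ 20))
    (hε100 : ε ≤ 1 / K ^ 100) (hεexp : ε ^ 2 ≤ exp (-(18 * M)) / (64 * M)) (hη : η ≤ 1 / 100)
    (hδ : 0 ≤ δ) (hon : K ^ 111 ≤ exp (M * δ / 8)) (hN4 : 2 * exp ((1 - sqrt K) / 10) ≤ 1 / K ^ 20)
    (hτ1 : 1 ≤ τ) (hfit : τ + δ + (sqrt K)⁻¹ ≤ 2)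
    (hcτ : ∀ t, 0 ≤ t → t ≤ τ → X t 2 ≤ ε ^ 2 / K ^ 10) (hcτeq : X τ 2 = ε ^ 2 / K ^ 10)
    {t : ℝ} (ht : t ∈ Icc (τ + δ + 1 / sqrt K) 2) :
    X t 0 ^ 2 + X t 1 ^ 2 + X t 2 ^ 2 + X t 3 ^ 2 ≤ 142 / K ^ 20 := by
  have hK0 : 0 < K := by linarith
  have hK1 : 1 ≤ K := by linarith
  obtain ⟨hs0, hs4, hKs, h4, hKs2⟩ := invSqrt_facts hK
  have hτ2 : τ ≤ 2 := by linarith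
  have htI : t ∈ Icc (τ + δ) 2 := ⟨by rw [one_div] at ht; linarith [ht.1], ht.2⟩
  have hEs := Es_decay hX hE h0 hε hε1 hM0 hMK hK hεK hε100 hεexp hη hδ hon hτ1 hfit hcτ hcτeq ht
  have hVt := (abs_le.1 (KVe_small hX hE h0 hε hε1 hM0 hMK hK hεK hεexp hη hδ hon hτ1 hτ2 hcτ hcτeq
    htI)).2
  have h99 : 1 / 2 / K ^ 99 ≤ 1 / 2 / K ^ 20 := by
    apply div_le_div_of_nonneg_left (by norm_num) (by positivity)
    exact pow_le_pow_right₀ hK1 (by norm_num)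
  have h90 : 70 / K ^ 90 ≤ 70 / K ^ 20 := by
    apply div_le_div_of_nonneg_left (by norm_num) (by positivity)
    exact pow_le_pow_right₀ hK1 (by norm_num)
  have hexp20 : exp ((1 - sqrt K) / 10) ≤ 1 / 2 / K ^ 20 := by
    have h := hN4
    rw [div_div, le_div_iff₀ (by positivity)]
    rw [le_div_iff₀ (by positivity)] at h
    linarith
  have hw1 : (1 : ℝ) / 2 / K ^ 20 = 1 / 2 * (K ^ 20)⁻¹ := by ring
  have hw2 : (70 : ℝ) / K ^ 20 = 70 * (K ^ 20)⁻¹ := by ring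
  have hw3 : (142 : ℝ) / K ^ 20 = 142 * (K ^ 20)⁻¹ := by ring
  rw [hw3]
  rw [hw1] at hexp20 h99
  rw [hw2] at h90
  linarith

/-- From `Σ_{i<4} Xᵢ² ≤ 142K⁻²⁰`, `ã ≥ 0` and the energy SANDWICH `1 - 2ηt ≤ Σ Xᵢ² ≤ 1`: all of
(beable), with `|ã - 1| ≤ 200K⁻¹⁰ + 4η`. [cite: Tao2016AveragedNS, §5.5 (beable)] -/
theorem beable_of_sum_sq
    (hX : ∀ t ∈ Icc (0:ℝ) 2, HasDerivAt X (delayCircuitWith K M ε (X t) - E t * X t) t)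
    (hE : ∀ t ∈ Icc (0:ℝ) 2, ∀ i, 0 ≤ E t i ∧ E t i ≤ η) (h0 : X 0 = delayInit)
    (hK : 16 ≤ K) {t : ℝ} (ht : t ∈ Icc (0:ℝ) 2)
    (hS : X t 0 ^ 2 + X t 1 ^ 2 + X t 2 ^ 2 + X t 3 ^ 2 ≤ 142 / K ^ 20) :
    |X t 4 - 1| ≤ 200 / K ^ 10 + 4 * η ∧ ∀ i : Fin 5, i ≠ 4 → |X t i| ≤ 200 / K ^ 10 := by
  have hK0 : 0 < K := by linarith
  have hK1 : 1 ≤ K := by linarith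
  have hη0 : 0 ≤ η := (hE 0 ⟨le_rfl, zero_le_two⟩ 0).1.trans (hE 0 ⟨le_rfl, zero_le_two⟩ 0).2
  obtain ⟨hSlo, hShi⟩ := sum_sq_sandwich hX hE h0 ht
  have he0 : 0 ≤ X t 4 := e_nonneg hX hE h0 hK0.le ht
  have he1 : X t 4 ≤ 1 := (le_abs_self _).trans (traj_abs_le_one hX hE h0 ht 4)
  have h2010 : 142 / K ^ 20 ≤ 142 / K ^ 10 := by
    apply div_le_div_of_nonneg_left (by norm_num) (by positivity)
    exact pow_le_pow_right₀ hK1 (by norm_num)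
  have h142 : 142 / K ^ 10 ≤ 200 / K ^ 10 :=
    div_le_div_of_nonneg_right (by norm_num) (by positivity)
  have hsq : ∀ x : ℝ, x ^ 2 ≤ 142 / K ^ 20 → |x| ≤ 200 / K ^ 10 := by
    intro x hx
    have hx' : x ^ 2 ≤ (12 / K ^ 10) ^ 2 := by
      rw [div_pow, show (K ^ 10) ^ 2 = K ^ 20 by ring]
      exact hx.trans (div_le_div_of_nonneg_right (by norm_num) (by positivity))
    calc |x| ≤ sqrt ((12 / K ^ 10) ^ 2) := abs_le_sqrt hx'
      _ = 12 / K ^ 10 := sqrt_sq (by positivity)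
      _ ≤ 200 / K ^ 10 := div_le_div_of_nonneg_right (by norm_num) (by positivity)
  have hx0 : X t 0 ^ 2 ≤ 142 / K ^ 20 := by
    linarith [sq_nonneg (X t 1), sq_nonneg (X t 2), sq_nonneg (X t 3)]
  have hx1 : X t 1 ^ 2 ≤ 142 / K ^ 20 := by
    linarith [sq_nonneg (X t 0), sq_nonneg (X t 2), sq_nonneg (X t 3)]
  have hx2 : X t 2 ^ 2 ≤ 142 / K ^ 20 := by
    linarith [sq_nonneg (X t 0), sq_nonneg (X t 1), sq_nonneg (X t 3)]
  have hx3 : X t 3 ^ 2 ≤ 142 / K ^ 20 := by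
    linarith [sq_nonneg (X t 0), sq_nonneg (X t 1), sq_nonneg (X t 2)]
  have ha := hsq _ hx0
  have hb := hsq _ hx1
  have hc := hsq _ hx2
  have hd := hsq _ hx3
  refine ⟨?_, ?_⟩
  · rw [abs_sub_comm, abs_of_nonneg (by linarith)]
    have h1 : 1 - X t 4 ≤ 1 - X t 4 ^ 2 := by nlinarith
    have h2 : 2 * η * t ≤ 2 * η * 2 := mul_le_mul_of_nonneg_left ht.2 (by positivity)
    linarith
  · intro i hi
    fin_cases i
    · exact ha
    · exact hb
    · exact hc
    · exact hd
    · exact absurd rfl hi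

/-- (able) with constant `200` (+ `2η` on `a`), on all of `[0, t_c]`.
[cite: Tao2016AveragedNS, §5.5 (able2)] -/
theorem able_window
    (hX : ∀ t ∈ Icc (0:ℝ) 2, HasDerivAt X (delayCircuitWith K M ε (X t) - E t * X t) t)
    (hE : ∀ t ∈ Icc (0:ℝ) 2, ∀ i, 0 ≤ E t i ∧ E t i ≤ η) (h0 : X 0 = delayInit)
    (hε : 0 < ε) (hε1 : ε ≤ 1) (hM0 : 0 ≤ M) (hK : 16 ≤ K) (hεK : ε ^ 2 ≤ 1 / (6 * K ^ 20))
    (hε100 : ε ≤ 1 / K ^ 100) (hτ2 : τ ≤ 2)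
    (hcτ : ∀ t, 0 ≤ t → t ≤ τ → X t 2 ≤ ε ^ 2 / K ^ 10)
    {t : ℝ} (ht : t ∈ Icc 0 τ) :
    |X t 0 - 1| ≤ 200 / K ^ 10 + 2 * η ∧ ∀ i : Fin 5, i ≠ 0 → |X t i| ≤ 200 / K ^ 10 := by
  have hK0 : 0 < K := by linarith
  have hK1 : 1 ≤ K := by linarith
  have ht2 : t ∈ Icc (0 : ℝ) 2 := ⟨ht.1, ht.2.trans hτ2⟩
  have ha := a_window hX hE h0 hε hε1 hM0 hK0 hτ2 hεK hcτ ht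
  obtain ⟨hb, hc⟩ := bc_small hX hE h0 hε hε1 hM0 ht2
  obtain ⟨hd, he⟩ := de_small hX hE h0 hε hε1 hM0 hK0 hτ2 hcτ ht
  have h20 : 8 / K ^ 20 ≤ 200 / K ^ 10 := by
    calc 8 / K ^ 20 ≤ 8 / K ^ 10 := by
          apply div_le_div_of_nonneg_left (by norm_num) (by positivity)
          exact pow_le_pow_right₀ hK1 (by norm_num)
      _ ≤ 200 / K ^ 10 := div_le_div_of_nonneg_right (by norm_num) (by positivity)
  have h5 : 5 * ε ≤ 200 / K ^ 10 := by
    have h1 : 1 / K ^ 100 ≤ 1 / K ^ 10 := by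
      apply div_le_div_of_nonneg_left (by norm_num) (by positivity)
      exact pow_le_pow_right₀ hK1 (by norm_num)
    have h2 : 5 * (1 / K ^ 10) ≤ 200 / K ^ 10 := by
      rw [mul_one_div]; exact div_le_div_of_nonneg_right (by norm_num) (by positivity)
    linarith
  have h3 : 3 / K ^ 10 ≤ 200 / K ^ 10 := div_le_div_of_nonneg_right (by norm_num) (by positivity)
  have hb' := hb.trans h5
  have hc' := hc.trans h5
  have hd' := hd.trans h3
  have he' := he.trans h3
  refine ⟨by linarith, ?_⟩
  intro i hi
  fin_cases i
  · exact absurd rfl hi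
  · exact hb'
  · exact hc'
  · exact hd'
  · exact he'

end Decay

section Assembly

/-! ## Assembly of the damped gate theorem for the family -/

/-- The damped onset delay `δ = 888·log K / M`: `e^{Mδ/8} = K¹¹¹`, and `δ ≤ 888/3000` on the family.
[cite: Tao2016AveragedNS, Theorem 5.3 ("for `K` large enough")] -/
theorem family_params_damped {K M : ℝ} (hK : 2 * 20 ^ 42 * (Nat.factorial 42 : ℝ) + 16 ≤ K)
    (hML : 3000 * Real.log K ≤ M) :
    0 ≤ 888 * Real.log K / M ∧ K ^ 111 ≤ exp (M * (888 * Real.log K / M) / 8) ∧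
      888 * Real.log K / M ≤ 888 / 3000 := by
  obtain ⟨hK16, hM0, -, hlog2, -⟩ := family_params hK hML
  have hK0 : 0 < K := by linarith
  have hδ0 : 0 ≤ 888 * Real.log K / M := div_nonneg (by nlinarith) hM0.le
  have hexp : M * (888 * Real.log K / M) / 8 = (111 : ℕ) * Real.log K := by
    push_cast; field_simp; ring
  have hon : K ^ 111 ≤ exp (M * (888 * Real.log K / M) / 8) := by
    rw [hexp, Real.exp_nat_mul, Real.exp_log hK0]
  have hLM : Real.log K / M ≤ 1 / 3000 := by
    rw [div_le_div_iff₀ hM0 (by norm_num)]; linarith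
  have hδle : 888 * Real.log K / M ≤ 888 / 3000 := by
    rw [mul_div_assoc]; linarith
  exact ⟨hδ0, hon, hδle⟩

/-- The damped second window fits inside `[0,2]`: `τ² ≤ 2 + 1/3000 + 20η ≤ 2.021` (`τ ≤ 1.422`),
`δ ≤ 888/3000`, `1/√K ≤ 1/4`. [cite: Tao2016AveragedNS, §5.5 ("for `K` large enough")] -/
theorem window_fits_damped {K M τ δ η : ℝ} (hK : 16 ≤ K) (hτ1 : 1 ≤ τ)
    (hhi : τ ^ 2 ≤ 2 + 2 / M + 20 * η) (h2M : 2 / M ≤ 1 / 3000) (hη : η ≤ 1 / 1000)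
    (hδ : δ ≤ 888 / 3000) : τ + δ + (sqrt K)⁻¹ ≤ 2 := by
  obtain ⟨hs0, hs4, hKs, h4, hKs2⟩ := invSqrt_facts hK
  have hτsq : τ ^ 2 ≤ 2021 / 1000 := by linarith
  have hτ : τ ≤ 1422 / 1000 := by nlinarith
  linarith

end Assembly

end DampedTransition

open DampedTransition in
/-- **THE DAMPED GATE THEOREM (Theorem 5.3 of [Tao2016AveragedNS] for the family, under non-uniform
diagonal damping).** For `K ≥ 2·20⁴²·42! + 16`, `3000 log K ≤ M ≤ K¹⁰`, `0 < ε ≤ e^{-10M}/K¹⁰⁰`, ANY diagonal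
damping `0 ≤ Eᵢ(t) ≤ η ≤ 1/1000` on `[0,2]` and ANY `X` with `Ẋ = delayCircuitWith K M ε X - E(t) * X` on
`[0,2]` from `delayInit`: a critical time `t_c` with `|t_c - √2| ≤ 24 log K / M + 20η`; (able) on ALL of
`[0, t_c]` — `|a - 1| ≤ 200K⁻¹⁰ + 2η`, `|b|,|c|,|d|,|ã| ≤ 200K⁻¹⁰`; (beable) on `[t_c + 888 log K/M + 1/√K, 2]`
— `|ã - 1| ≤ 200K⁻¹⁰ + 4η`, `|a|,|b|,|c|,|d| ≤ 200K⁻¹⁰`. The damping enters ONLY through `η` in three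
places (t_c, the `a`-level, the `ã`-level) and through `880 ↦ 888` in the onset delay. HONEST FRAMING:
a theorem about a five-mode ODE; low prior, high value-of-information experiment on Tao's machine paradigm; NOT a
claim that NS blows up. [cite: Tao2016AveragedNS, Theorem 5.3, §5.5] -/
theorem DampedTransition.firingPhase {K M ε η : ℝ} {E X : ℝ → Fin 5 → ℝ}
    (hX : ∀ t ∈ Icc (0:ℝ) 2, HasDerivAt X (delayCircuitWith K M ε (X t) - E t * X t) t)
    (hE : ∀ t ∈ Icc (0:ℝ) 2, ∀ i, 0 ≤ E t i ∧ E t i ≤ η) (h0 : X 0 = delayInit)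
    (hK : 2 * 20 ^ 42 * (Nat.factorial 42 : ℝ) + 16 ≤ K) (hML : 3000 * Real.log K ≤ M)
    (hMK : M ≤ K ^ 10) (hε : 0 < ε) (hεle : ε ≤ exp (-(10 * M)) / K ^ 100) (hη : η ≤ 1 / 1000) :
    ∃ tc : ℝ, |tc - Real.sqrt 2| ≤ 24 * Real.log K / M + 20 * η ∧
      (∀ t ∈ Icc 0 tc,
        |X t 0 - 1| ≤ 200 / K ^ 10 + 2 * η ∧ ∀ i : Fin 5, i ≠ 0 → |X t i| ≤ 200 / K ^ 10) ∧
      (∀ t ∈ Icc (tc + 888 * Real.log K / M + 1 / Real.sqrt K) 2,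
        |X t 4 - 1| ≤ 200 / K ^ 10 + 4 * η ∧ ∀ i : Fin 5, i ≠ 4 → |X t i| ≤ 200 / K ^ 10) := by
  obtain ⟨hK16, hM0, hML48, hlog2, hN4, -, -, -, h2M⟩ := family_params hK hML
  obtain ⟨hδ0, hon, hδle⟩ := family_params_damped hK hML
  have hK0 : 0 < K := by linarith
  have hη0 : 0 ≤ η := (hE 0 ⟨le_rfl, zero_le_two⟩ 0).1.trans (hE 0 ⟨le_rfl, zero_le_two⟩ 0).2
  have hη100 : η ≤ 1 / 100 := hη.trans (by norm_num)
  obtain ⟨hε1, hεK, hε100, hεexp⟩ := eps_facts hK16 hM0 hMK hε hεle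
  obtain ⟨τ, ⟨hlo, hhi, hτ1, hτ32⟩, hcτeq, hwin⟩ :=
    quietPhase hX hE h0 hε hε1 hM0 hMK hK16 hML48 hεK hη100
  have hτ2 : τ ≤ 2 := by linarith
  have hcτ : ∀ t, 0 ≤ t → t ≤ τ → X t 2 ≤ ε ^ 2 / K ^ 10 :=
    fun t h0t htτ => (hwin t ⟨h0t, htτ⟩).1.2
  have hfit : τ + 888 * Real.log K / M + (sqrt K)⁻¹ ≤ 2 :=
    window_fits_damped hK16 hτ1 hhi h2M hη hδle
  refine ⟨τ, ?_, ?_, ?_⟩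
  · have hlog0 : 0 ≤ Real.log K := by linarith
    have hx : 0 ≤ 24 * Real.log K / M + 20 * η := by positivity
    have hyx : 2 / M + 20 * η ≤ 24 * Real.log K / M + 20 * η := by
      have : 2 / M ≤ 24 * Real.log K / M := div_le_div_of_nonneg_right (by linarith) hM0.le
      linarith
    exact abs_sub_sqrt_two_le hτ1 hx hyx (by linarith) (by linarith)
  · intro t ht
    exact able_window hX hE h0 hε hε1 hM0.le hK16 hεK hε100 hτ2 hcτ ht
  · intro t ht
    have ht0 : t ∈ Icc (0:ℝ) 2 := by
      refine ⟨?_, ht.2⟩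
      have : 0 < (sqrt K)⁻¹ := (invSqrt_facts hK16).1
      have h1 := ht.1
      rw [one_div] at h1
      linarith
    exact beable_of_sum_sq hX hE h0 hK16 ht0
      (late_sum_sq hX hE h0 hε hε1 hM0 hMK hK16 hεK hε100 hεexp hη100 hδ0 hon hN4 hτ1 hfit
        hcτ hcτeq ht)

end Summit.NavierStokesRegularity.FluidComputer
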